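import Literature.NumberTheory.Automorphic.ShimuraCurveRibetTakahashiPeterssonTwistDescentProofs
import Literature.NumberTheory.Automorphic.ShimuraCurveRibetTakahashiCokernelProofs
import Literature.NumberTheory.DiophantineGeometry.FreyCurveConductorTwoTwistDichotomyProofs
import Literature.NumberTheory.EllipticCurves.QuadraticTwistJInvariantProofs
import Literature.NumberTheory.EllipticCurves.CuspFormLFunctionLevelConductorProofs
import HarnessLib

/-!
# Mai–Murty's bound `(f, f) ≪ N (log N)³` for every Frey–Hellegouarch curve and for Pasten's
# printed class of Thm. 6.1 (b)

Topic `NumberTheory/Automorphic`; namespace `Literature.NumberTheory.Automorphic`. A proofs-only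
file (theorems only, no definition, no named fact; D-0026), closing the work on the named fact
`murty_petersson_newform_upper_bound` of `ShimuraCurveRibetTakahashi.lean` (`‖f‖² ≪ N log N`,
H. Pasten, *Shimura curves and the abc conjecture*, arXiv:1705.09251, §16 p. 49, from [MaiMurty1994],
[MurtyBounds]) **for the class of curves on which the `abc` routes consume it**: conductor with
squarefree odd part and `E` semistable or Frey–Hellegouarch
(`Summits/ABC/ABC/Theorems/RibetTakahashiSplitManyPrimeValuationProductJLPackagePrintedClass.lean`,
hypotheses `hss`, `hclass`; Pasten Thm. 6.1 (b.1)/(b.2)). As recorded on that fact's docstring, the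
exponent `1` of `log N` is not what the cited proof gives (Mai–Murty 1994, §2 prove
`L(1, Sym² f) = O((log N)³)`, i.e. `(f, f) ≪ N (log N)³`); the printed-strength statement is what is
proved here, with an absolute constant:

* `exists_petersson_le_mul_log_cube_of_isFreyHellegouarch` — granted the Modularity Theorem in the
  tree's form `exists_isNewformOf` (newforms of the twists at level = conductor), there is `C > 0`
  with `Re (f, f)_{Γ₀(N)} ≤ C · N · (1 + log N)³` for the newform `f ∈ S₂(Γ₀(N))` of **every**
  Frey–Hellegouarch curve `E ≅ E_{a,b} : y² = x(x−a)(x+b)` (`a, b ≥ 1` coprime, no congruence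
  condition; `IsFreyHellegouarch`);
* `exists_petersson_le_mul_log_cube_of_printedClass` — the same for every `E` with
  `p² ∤ N_E` (`p` odd) and (`N_E` squarefree or `E` Frey–Hellegouarch), literally the hypotheses
  `hss`, `hclass` of the `abc` dependents; `…_of_isSemistable_or_isFreyHellegouarch` with
  `IsSemistable`; power forms `≤ C · N^{1+ε}/ε³` and `≤ C_ε · N^{1+ε}`, and `log` forms;
* `IsFreyHellegouarch.re_petersson_le_of_isNewformOf` — a modularity-free form with the three
  newforms (of `E`, `E^{(−1)}`, `(E^{(−1)})^{(−1)}`) as explicit data at conductor level.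

## The argument

Everything is assembled from theorems of the tree:

1. **The `2`-adic dichotomy** (`IsFreyHellegouarch.not_sixtyfour_dvd_conductorNorm_or_quadraticTwist_neg_one`):
   for `E` Frey–Hellegouarch, `64 ∤ N_E` or `64 ∤ N_{E^{(−1)}}`.  Diamond–Kramer 1995 (as quoted in
   Ribet 1997 §2 pp. 10–11) compute `ord₂ N(E_{A,B}) ∈ {5, 3, 3, 0, 1}` for the normalised
   presentation `A ≡ −1 (mod 4)`, `2 ∣ B`; the tree has these rows
   (`DenesEquationFreyCurveTwoProofs`, `GeneralizedFermatTwoPowerCoefficientFrey(Two)Proofs`), and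
   `FreyCurveConductorTwoTwistDichotomyProofs` shows that an arbitrary coprime `E_{a,b}` either admits
   such a presentation (`ord₂ N ≤ 5`) or its twist `E_{a,b}^{(−1)} = E_{b,a}` does (`ord₂ N ≤ 3`).
   The conductor and the twist are transported along the `ℚ`-isomorphism `C • E = E_{a,b}` by
   `conductorNorm_smul_rat` and `quadraticTwist_smul`.
2. **Odd part**: `q² ∤ N_E` for odd `q` (`not_sq_dvd_conductorNorm_of_isFreyHellegouarch`,
   `N(E_{a,b}) ∣ 2⁸ rad(ab(a+b))`).
3. **Level = conductor** for the newform `f` of `E`, from modularity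
   (`IsNewformOf.level_eq_conductorNorm_of_exists_isNewformOf`, strong multiplicity one across levels).
4. **The bound**: `exists_petersson_le_mul_log_cube_of_exists_isNewformOf`
   (`ShimuraCurveRibetTakahashiPeterssonTwistDescentProofs`): Mai–Murty's `(f,f) ≪ N (log N)³` for
   every `E` with squarefree odd conductor and `64 ∤ N` or `64 ∤ N_{E^{(d)}}`, `d ∈ {−1, 2, −2}` —
   itself the Phragmén–Lindelöf argument of Mai–Murty §2 on the tree's Rankin–Selberg continuation at
   the levels `2ᵗM`, `t ≤ 5` (`…ConvexityCubeProofs`, `…TwoPowerLevel(Twist)Proofs`) descended along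
   the twist by `−1` (`…TwistDescentProofs`).

What is NOT here: the exponent `1` of `log N` (the named fact as stated; open-strength, see its
docstring); curves with `v₂(N) ∈ {7, 8}` or with `p² ∣ N` for an odd `p` (outside the printed class).

## References

* [MaiMurty1994] L. Mai, M. R. Murty, *The Phragmén–Lindelöf theorem and modular elliptic curves*,
  Contemp. Math. 166 (1994), §2, Proposition.
* [PastenShimura2024] H. Pasten, *Shimura curves and the abc conjecture*, J. Number Theory (2024) /
  arXiv:1705.09251, §3 p. 13 (Frey–Hellegouarch curves), Thm. 6.1 p. 21, §16 p. 49.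
* [DiamondKramer1995] F. Diamond, K. Kramer, *Modularity of a family of elliptic curves*, Math. Res.
  Lett. 2 (1995), 299–304.
* [Ribet1997] K. A. Ribet, *On the equation `a^p + 2^α b^p + c^p = 0`*, Acta Arith. 79 (1997), §2.
* [BreuilConradDiamondTaylor2001] C. Breuil, B. Conrad, F. Diamond, R. Taylor, *On the modularity of
  elliptic curves over `ℚ`*, J. Amer. Math. Soc. 14 (2001), Thm. A.
-/

noncomputable section

open scoped MatrixGroups ModularForm Real
open Complex CongruenceSubgroup
open Literature.NumberTheory.EllipticCurves Literature.NumberTheory.EllipticCurves.ModularForms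
open Literature.NumberTheory.DiophantineGeometry

namespace Literature.NumberTheory.Automorphic

/-! ### The `2`-adic dichotomy and the odd part, on `IsFreyHellegouarch` -/

section TwoAdic

variable {W : WeierstrassCurve ℚ} [W.IsElliptic]

/-- **`64 ∤ N_E` or `64 ∤ N_{E^{(−1)}}` for a Frey–Hellegouarch curve `E`.** If `C • E = E_{a,b}`
(`a, b ≥ 1` coprime) then `N_E = N(E_{a,b})` (`conductorNorm_smul_rat`) and
`N_{E^{(−1)}} = N(E_{a,b}^{(−1)}) = N(E_{b,a})` (`quadraticTwist_smul`, `conductorNorm_smul_rat`,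
`quadraticTwist_freyCurve_neg_one`), and Diamond–Kramer's table gives `ord₂ N(E_{a,b}) ≤ 5` or
`ord₂ N(E_{b,a}) ≤ 3` (`not_sixtyfour_dvd_conductorNorm_freyCurve_or_quadraticTwist_neg_one`).
[cite: Ribet1997, §2, pp. 10–11] [cite: DiamondKramer1995] [cite: PastenShimura2024, §3 p. 13] -/
theorem IsFreyHellegouarch.not_sixtyfour_dvd_conductorNorm_or_quadraticTwist_neg_one
    (hW : IsFreyHellegouarch W) :
    ¬ 64 ∣ W.conductorNorm ℤ ∨ ¬ 64 ∣ (W.quadraticTwist (-1)).conductorNorm ℤ := by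
  obtain ⟨a, b, C, ha, hb, hcop, hCW⟩ := hW
  have hab : IsCoprime (a : ℤ) (b : ℤ) := Nat.isCoprime_iff_coprime.mpr hcop
  have h0 : (a : ℤ) * b * (a + b) ≠ 0 := by positivity
  haveI := isElliptic_freyCurve h0
  haveI := W.isElliptic_quadraticTwist (show ((-1 : ℚ)) ≠ 0 by norm_num)
  have hN : W.conductorNorm ℤ = (freyCurve a b).conductorNorm ℤ := by
    rw [← W.conductorNorm_smul_rat C, hCW]
  have hN' : (W.quadraticTwist (-1)).conductorNorm ℤ =
      ((freyCurve a b).quadraticTwist (-1)).conductorNorm ℤ := by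
    rw [← hCW, W.quadraticTwist_smul C (-1), WeierstrassCurve.conductorNorm_smul_rat]
  rw [hN, hN']
  exact not_sixtyfour_dvd_conductorNorm_freyCurve_or_quadraticTwist_neg_one hab h0

/-- **The conductor of a Frey–Hellegouarch curve has squarefree odd part and `64 ∤ N_E` or
`64 ∤ N_{E^{(−1)}}`** — the two arithmetic inputs of the twist-descent bound, packaged.
[cite: PastenShimura2024, §3 p. 13] [cite: DiamondKramer1995] -/
theorem IsFreyHellegouarch.conductorNorm_shape (hW : IsFreyHellegouarch W) :
    (∀ p : ℕ, p.Prime → p ≠ 2 → ¬ p ^ 2 ∣ W.conductorNorm ℤ) ∧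
      (¬ 64 ∣ W.conductorNorm ℤ ∨ ¬ 64 ∣ (W.quadraticTwist (-1)).conductorNorm ℤ) :=
  ⟨fun _ hp hp2 ↦ not_sq_dvd_conductorNorm_of_isFreyHellegouarch hW hp hp2,
    hW.not_sixtyfour_dvd_conductorNorm_or_quadraticTwist_neg_one⟩

end TwoAdic

/-! ### Under the Modularity Theorem: Frey–Hellegouarch curves and the printed class -/

section Modularity

/-- **Mai–Murty's `(f, f) ≪ N (log N)³` on Pasten's printed class of Thm. 6.1 (b), from the
Modularity Theorem.** Assume `exists_isNewformOf`. There is an absolute `C > 0` such that for every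
elliptic `E/ℚ` whose conductor has squarefree odd part (`p² ∤ N_E`, `p` odd) and which is either of
squarefree conductor or Frey–Hellegouarch — literally the hypotheses `hss`, `hclass` of
`jlPackage_printedClass_of_facts` — and every newform `f ∈ S₂(Γ₀(N))` of `E` (`IsNewformOf E f`; then
`N = N_E`), `Re (f, f)_{Γ₀(N)} ≤ C · N · (1 + log N)³`.  Squarefree `N_E`: `4 ∤ N`; Frey–Hellegouarch:
`64 ∤ N_E` or `64 ∤ N_{E^{(−1)}}` (`IsFreyHellegouarch.not_sixtyfour_dvd_conductorNorm_or_quadraticTwist_neg_one`);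
in all cases `exists_petersson_le_mul_log_cube_of_exists_isNewformOf` applies. This is the
printed-strength form of `murty_petersson_newform_upper_bound` on that class (exponent `3`, Mai–Murty
1994 §2, in place of the fact's unproved exponent `1`). [cite: MaiMurty1994, §2, Proposition]
[cite: PastenShimura2024, Thm. 6.1 p. 21 and §16 p. 49] [cite: BreuilConradDiamondTaylor2001, Thm. A] -/
theorem exists_petersson_le_mul_log_cube_of_printedClass (hmod : exists_isNewformOf) :
    ∃ C : ℝ, 0 < C ∧ ∀ (N : ℕ) [NeZero N] (W : WeierstrassCurve ℚ) [W.IsElliptic]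
      (f : CuspForm (Gamma0 N) 2), IsNewformOf W f →
      (∀ p : ℕ, p.Prime → p ≠ 2 → ¬ p ^ 2 ∣ W.conductorNorm ℤ) →
      ((∀ p : ℕ, p.Prime → ¬ p ^ 2 ∣ W.conductorNorm ℤ) ∨ IsFreyHellegouarch W) →
      (peterssonProduct (Gamma0 N) 2 f f).re ≤ C * N * (1 + Real.log N) ^ 3 := by
  obtain ⟨C, hC, h⟩ := exists_petersson_le_mul_log_cube_of_exists_isNewformOf hmod
  refine ⟨C, hC, fun N _ W _ f hf hodd hclass ↦ ?_⟩
  have hNeq : N = W.conductorNorm ℤ := hf.level_eq_conductorNorm_of_exists_isNewformOf hmod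
  have hodd' : ∀ p : ℕ, p.Prime → p ≠ 2 → ¬ p ^ 2 ∣ N := by rw [hNeq]; exact hodd
  refine h N W f hf hodd' ?_
  rcases hclass with hsq | hFH
  · exact Or.inl fun h64 ↦ hsq 2 Nat.prime_two
      (hNeq ▸ (show (2 : ℕ) ^ 2 ∣ 64 by norm_num).trans h64)
  · rcases hFH.not_sixtyfour_dvd_conductorNorm_or_quadraticTwist_neg_one with h64 | h64
    · exact Or.inl (hNeq ▸ h64)
    · exact Or.inr ⟨-1, Or.inl rfl, by exact_mod_cast h64⟩

/-- **The same class written with `IsSemistable`**: `p² ∤ N_E` for odd `p` and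
(`E` semistable or Frey–Hellegouarch) — Pasten Thm. 6.1 (b.1)/(b.2) with the odd-squarefree
condition (`isSemistable_iff_squarefree_conductorNorm`). [cite: MaiMurty1994, §2, Proposition]
[cite: PastenShimura2024, Thm. 6.1 p. 21] -/
theorem exists_petersson_le_mul_log_cube_of_isSemistable_or_isFreyHellegouarch
    (hmod : exists_isNewformOf) :
    ∃ C : ℝ, 0 < C ∧ ∀ (N : ℕ) [NeZero N] (W : WeierstrassCurve ℚ) [W.IsElliptic]
      (f : CuspForm (Gamma0 N) 2), IsNewformOf W f →
      (∀ p : ℕ, p.Prime → p ≠ 2 → ¬ p ^ 2 ∣ W.conductorNorm ℤ) →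
      (W.IsSemistable ℤ ∨ IsFreyHellegouarch W) →
      (peterssonProduct (Gamma0 N) 2 f f).re ≤ C * N * (1 + Real.log N) ^ 3 := by
  obtain ⟨C, hC, h⟩ := exists_petersson_le_mul_log_cube_of_printedClass hmod
  refine ⟨C, hC, fun N _ W _ f hf hodd hclass ↦ h N W f hf hodd ?_⟩
  rcases hclass with hss | hFH
  · exact Or.inl fun p hp ↦ not_sq_dvd_conductorNorm_of_isSemistable W hss hp
  · exact Or.inr hFH

/-- **Mai–Murty's `(f, f) ≪ N (log N)³` for every Frey–Hellegouarch curve, from the Modularity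
Theorem**: there is an absolute `C > 0` with `Re (f, f)_{Γ₀(N)} ≤ C · N · (1 + log N)³` for the
newform `f ∈ S₂(Γ₀(N))` of every `E ≅ E_{a,b} : y² = x(x−a)(x+b)`, `a, b ≥ 1` coprime (no congruence
condition; `N = N_E`). The odd part of `N_E` is squarefree
(`not_sq_dvd_conductorNorm_of_isFreyHellegouarch`). [cite: MaiMurty1994, §2, Proposition]
[cite: PastenShimura2024, §3 p. 13 and §16 p. 49] [cite: DiamondKramer1995] -/
theorem exists_petersson_le_mul_log_cube_of_isFreyHellegouarch (hmod : exists_isNewformOf) :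
    ∃ C : ℝ, 0 < C ∧ ∀ (N : ℕ) [NeZero N] (W : WeierstrassCurve ℚ) [W.IsElliptic]
      (f : CuspForm (Gamma0 N) 2), IsNewformOf W f → IsFreyHellegouarch W →
      (peterssonProduct (Gamma0 N) 2 f f).re ≤ C * N * (1 + Real.log N) ^ 3 := by
  obtain ⟨C, hC, h⟩ := exists_petersson_le_mul_log_cube_of_printedClass hmod
  exact ⟨C, hC, fun N _ W _ f hf hW ↦ h N W f hf hW.conductorNorm_shape.1 (Or.inr hW)⟩

/-- **Power form** on the printed class: `Re (f, f) ≤ C · N^{1+ε}/ε³` for `0 < ε ≤ 1`, `C` absolute.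
[cite: MaiMurty1994, §2, Proposition] -/
theorem exists_petersson_le_mul_rpow_of_printedClass (hmod : exists_isNewformOf) :
    ∃ C : ℝ, 0 < C ∧ ∀ ε : ℝ, 0 < ε → ε ≤ 1 → ∀ (N : ℕ) [NeZero N] (W : WeierstrassCurve ℚ)
      [W.IsElliptic] (f : CuspForm (Gamma0 N) 2), IsNewformOf W f →
      (∀ p : ℕ, p.Prime → p ≠ 2 → ¬ p ^ 2 ∣ W.conductorNorm ℤ) →
      ((∀ p : ℕ, p.Prime → ¬ p ^ 2 ∣ W.conductorNorm ℤ) ∨ IsFreyHellegouarch W) →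
      (peterssonProduct (Gamma0 N) 2 f f).re ≤ C * (N : ℝ) ^ (1 + ε) / ε ^ 3 := by
  obtain ⟨C, hC, hmain⟩ := exists_petersson_le_mul_log_cube_of_printedClass hmod
  refine ⟨C * 4 ^ 3, by positivity, ?_⟩
  intro ε hε hε1 N _ W _ f hf hodd hclass
  have hN1 : (1 : ℝ) ≤ N := by exact_mod_cast NeZero.one_le (n := N)
  calc (peterssonProduct (Gamma0 N) 2 f f).re ≤ C * N * (1 + Real.log N) ^ 3 :=
        hmain N W f hf hodd hclass
    _ = C * (N * (1 + Real.log N) ^ 3) := by ring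
    _ ≤ C * (4 ^ 3 * (N : ℝ) ^ (1 + ε) / ε ^ 3) :=
        mul_le_mul_of_nonneg_left (mul_one_add_log_pow_three_le_rpow hN1 hε hε1) hC.le
    _ = C * 4 ^ 3 * (N : ℝ) ^ (1 + ε) / ε ^ 3 := by ring

/-- **Power form** for Frey–Hellegouarch curves: `Re (f, f) ≤ C · N^{1+ε}/ε³` for `0 < ε ≤ 1`.
[cite: MaiMurty1994, §2, Proposition] -/
theorem exists_petersson_le_mul_rpow_of_isFreyHellegouarch (hmod : exists_isNewformOf) :
    ∃ C : ℝ, 0 < C ∧ ∀ ε : ℝ, 0 < ε → ε ≤ 1 → ∀ (N : ℕ) [NeZero N] (W : WeierstrassCurve ℚ)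
      [W.IsElliptic] (f : CuspForm (Gamma0 N) 2), IsNewformOf W f → IsFreyHellegouarch W →
      (peterssonProduct (Gamma0 N) 2 f f).re ≤ C * (N : ℝ) ^ (1 + ε) / ε ^ 3 := by
  obtain ⟨C, hC, h⟩ := exists_petersson_le_mul_rpow_of_printedClass hmod
  exact ⟨C, hC, fun ε hε hε1 N _ W _ f hf hW ↦
    h ε hε hε1 N W f hf hW.conductorNorm_shape.1 (Or.inr hW)⟩

/-- **`ε`-form on the printed class** (the shape `∀ ε > 0, ∃ C_ε, Re (f, f) ≤ C_ε · N^{1+ε}` in which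
the `abc` routes consume the Petersson bound): for every `ε > 0` there is `C_ε` with
`Re (f, f) ≤ C_ε · N^{1+ε}` on the class. [cite: MaiMurty1994, §2, Proposition] -/
theorem exists_petersson_le_mul_rpow_of_printedClass' (hmod : exists_isNewformOf) {ε : ℝ}
    (hε : 0 < ε) :
    ∃ C : ℝ, 0 < C ∧ ∀ (N : ℕ) [NeZero N] (W : WeierstrassCurve ℚ) [W.IsElliptic]
      (f : CuspForm (Gamma0 N) 2), IsNewformOf W f →
      (∀ p : ℕ, p.Prime → p ≠ 2 → ¬ p ^ 2 ∣ W.conductorNorm ℤ) →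
      ((∀ p : ℕ, p.Prime → ¬ p ^ 2 ∣ W.conductorNorm ℤ) ∨ IsFreyHellegouarch W) →
      (peterssonProduct (Gamma0 N) 2 f f).re ≤ C * (N : ℝ) ^ (1 + ε) := by
  obtain ⟨C, hC, h⟩ := exists_petersson_le_mul_rpow_of_printedClass hmod
  set δ : ℝ := min ε 1 with hδ
  have hδ0 : 0 < δ := lt_min hε one_pos
  have hδ1 : δ ≤ 1 := min_le_right _ _
  have hδε : δ ≤ ε := min_le_left _ _
  refine ⟨C / δ ^ 3, by positivity, fun N _ W _ f hf hodd hclass ↦ ?_⟩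
  have hN1 : (1 : ℝ) ≤ N := by exact_mod_cast NeZero.one_le (n := N)
  calc (peterssonProduct (Gamma0 N) 2 f f).re ≤ C * (N : ℝ) ^ (1 + δ) / δ ^ 3 :=
        h δ hδ0 hδ1 N W f hf hodd hclass
    _ ≤ C * (N : ℝ) ^ (1 + ε) / δ ^ 3 := by gcongr
    _ = C / δ ^ 3 * (N : ℝ) ^ (1 + ε) := by ring

/-- **`log` form on the printed class**: `log Re (f, f) ≤ log N + 3 log (1 + log N) + C`, i.e.
`2 log ‖f‖ ≤ log N + O(log log N)` — the shape Pasten §16 p. 49 uses ("which gives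
`2 log ‖f‖ ≤ log N + O(log log N)`"). [cite: PastenShimura2024, §16 p. 49]
[cite: MaiMurty1994, §2, Proposition] -/
theorem exists_log_petersson_le_of_printedClass (hmod : exists_isNewformOf) :
    ∃ C : ℝ, ∀ (N : ℕ) [NeZero N] (W : WeierstrassCurve ℚ) [W.IsElliptic]
      (f : CuspForm (Gamma0 N) 2), IsNewformOf W f →
      (∀ p : ℕ, p.Prime → p ≠ 2 → ¬ p ^ 2 ∣ W.conductorNorm ℤ) →
      ((∀ p : ℕ, p.Prime → ¬ p ^ 2 ∣ W.conductorNorm ℤ) ∨ IsFreyHellegouarch W) →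
      Real.log (peterssonProduct (Gamma0 N) 2 f f).re ≤
        Real.log N + 3 * Real.log (1 + Real.log N) + C := by
  obtain ⟨C, hC, hmain⟩ := exists_petersson_le_mul_log_cube_of_printedClass hmod
  refine ⟨Real.log C, fun N _ W _ f hf hodd hclass ↦ ?_⟩
  have hN0 : (0 : ℝ) < N := Nat.cast_pos.mpr (NeZero.pos N)
  have hN1 : (1 : ℝ) ≤ N := by exact_mod_cast NeZero.one_le (n := N)
  have hl : 0 < 1 + Real.log N := by
    have := Real.log_nonneg hN1
    linarith
  have hpos : 0 < (peterssonProduct (Gamma0 N) 2 f f).re := hf.peterssonProduct_re_pos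
  have hb := hmain N W f hf hodd hclass
  calc Real.log (peterssonProduct (Gamma0 N) 2 f f).re
      ≤ Real.log (C * N * (1 + Real.log N) ^ 3) := Real.log_le_log hpos hb
    _ = Real.log N + 3 * Real.log (1 + Real.log N) + Real.log C := by
        rw [Real.log_mul (by positivity) (by positivity), Real.log_mul hC.ne' hN0.ne',
          Real.log_pow]
        push_cast
        ring

end Modularity

/-! ### Without the Modularity Theorem: the three newforms as data -/

section Explicit

/-- **Modularity-free form for Frey–Hellegouarch curves.** There is an absolute `C > 0` such that
for every Frey–Hellegouarch `E`, every newform `f ∈ S₂(Γ₀(N_E))` of `E`, `g ∈ S₂(Γ₀(N_{E^{(−1)}}))` of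
`E^{(−1)}` and `h` (any level) of `(E^{(−1)})^{(−1)} ≅ E`, one has
`Re (f, f)_{Γ₀(N_E)} ≤ C · N_E · (1 + log N_E)³`. (If `64 ∤ N_E`:
`exists_petersson_le_mul_log_cube_of_not_sixtyfour_dvd'` with `f, g`; otherwise `64 ∤ N_{E^{(−1)}}`
and `exists_petersson_le_mul_log_cube_of_quadraticTwist_not_sixtyfour_dvd` with `d = −1`, `f, g, h`.
The levels are taken equal to the conductors as hypotheses — Carayol's theorem, or
`IsNewformOf.level_eq_conductorNorm_of_exists_isNewformOf` under modularity.)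
[cite: MaiMurty1994, §2, Proposition] [cite: PastenShimura2024, §3 p. 13] [cite: DiamondKramer1995] -/
theorem IsFreyHellegouarch.re_petersson_le_of_isNewformOf :
    ∃ C : ℝ, 0 < C ∧ ∀ (W : WeierstrassCurve ℚ) [W.IsElliptic], IsFreyHellegouarch W →
      ∀ (N N₁ N₂ : ℕ) [NeZero N] [NeZero N₁] [NeZero N₂]
        (f : CuspForm (Gamma0 N) 2) (g : CuspForm (Gamma0 N₁) 2) (h : CuspForm (Gamma0 N₂) 2),
        IsNewformOf W f → IsNewformOf (W.quadraticTwist (-1)) g →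
        IsNewformOf ((W.quadraticTwist (-1)).quadraticTwist (-1)) h →
        N = W.conductorNorm ℤ → N₁ = (W.quadraticTwist (-1)).conductorNorm ℤ →
        (peterssonProduct (Gamma0 N) 2 f f).re ≤ C * N * (1 + Real.log N) ^ 3 := by
  obtain ⟨C₅, hC₅, h5⟩ := exists_petersson_le_mul_log_cube_of_not_sixtyfour_dvd'
  obtain ⟨C₆, hC₆, h6⟩ := exists_petersson_le_mul_log_cube_of_quadraticTwist_not_sixtyfour_dvd
  refine ⟨max C₅ C₆, lt_max_of_lt_left hC₅, ?_⟩
  intro W _ hW N N₁ N₂ _ _ _ f g h hf hg hh hN hN₁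
  have hN1 : (1 : ℝ) ≤ N := by exact_mod_cast NeZero.one_le (n := N)
  have hfac : 0 ≤ (N : ℝ) * (1 + Real.log N) ^ 3 := by
    have := Real.log_nonneg hN1
    positivity
  have hodd : ∀ p : ℕ, p.Prime → p ≠ 2 → ¬ p ^ 2 ∣ N := by
    rw [hN]; exact hW.conductorNorm_shape.1
  have e : ((-1 : ℤ) : ℚ) = -1 := by norm_num
  rcases hW.not_sixtyfour_dvd_conductorNorm_or_quadraticTwist_neg_one with h64 | h64
  · calc (peterssonProduct (Gamma0 N) 2 f f).re ≤ C₅ * N * (1 + Real.log N) ^ 3 :=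
          h5 N N₁ (hN ▸ h64) hodd W f g hf hg
      _ = C₅ * (N * (1 + Real.log N) ^ 3) := by ring
      _ ≤ max C₅ C₆ * (N * (1 + Real.log N) ^ 3) :=
          mul_le_mul_of_nonneg_right (le_max_left _ _) hfac
      _ = max C₅ C₆ * N * (1 + Real.log N) ^ 3 := by ring
  · calc (peterssonProduct (Gamma0 N) 2 f f).re ≤ C₆ * N * (1 + Real.log N) ^ 3 :=
          h6 (-1) (Or.inl rfl) N N₁ N₂ (hN₁ ▸ h64) hodd W f g h hf (by rw [e]; exact hg)
            (by rw [e]; exact hh)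
      _ = C₆ * (N * (1 + Real.log N) ^ 3) := by ring
      _ ≤ max C₅ C₆ * (N * (1 + Real.log N) ^ 3) :=
          mul_le_mul_of_nonneg_right (le_max_right _ _) hfac
      _ = max C₅ C₆ * N * (1 + Real.log N) ^ 3 := by ring

end Explicit

end Literature.NumberTheory.Automorphic
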